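import Summits.CriticalPhenomena.SAWScalingLimit.Theses.SAWTensorRG
import Summits.CriticalPhenomena.SAWScalingLimit.Theorems.SAWConePseudogroupLatticeSimilarityOfLimitTransport
import Literature.Probability.RandomPlanarGeometry.SAWScalingLimitFamily
import HarnessLib

/-!
# Dilation invariance of critical-SAW avoidance limits (crux `ConformalAvoidance`, route
# `SAWTensorRG`, line `birth`, stub `stub_dilationInvariantLimits`; item stmt-CriticalPhenomena-7605)

**What.** The registered stub `stub_dilationInvariantLimits` of the skeleton of line `birth`:
approximation independence of the avoidance limits (two endpoint approximations of the same
hull pair `(E, E')` give the same limit of `P_δ^E(range γ ⊆ closure E')` along `δ → 0+`) implies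
dilation invariance of the limit values: if `E = s D`, `E' = s D'` (`s > 0`, carriers AND marked
points transported by `z ↦ s z`), `(a, b)` is an endpoint approximation of `D` with avoidance
limit `r₁` and `(c, d)` one of `E` with avoidance limit `r₂`, then `r₁ = r₂`.

**How.** The exact lattice identity `(sΩ)_δ = s · Ω_{δ/s}` (`map_curve_law_dilate` of
`SAWConePseudogroupLatticeSimilarityOfLimitTransport.lean`): the critical SAW law of `(sΩ)_δ`
pushed to curves is the push-forward along `z ↦ s z` of the critical SAW law of `Ω_{δ/s}`.
Evaluated on the closed avoidance event `{range γ ⊆ closure (s S)}`, whose preimage under the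
push-forward along the homeomorphism `z ↦ s z` is `{range γ ⊆ closure S}`
(`preimage_curveClassMap_rangeSubset_closure_image`), this gives the mesh-by-mesh identity
`Av(sΩ, sS; a(·/s), b(·/s))(δ) = Av(Ω, S; a, b)(δ / s)` (`avoidance_dilate`). The transported
approximation `δ ↦ (a (δ/s), b (δ/s))` is an endpoint approximation of `E`
(`isEndpointApprox_dilate`, `SAW.IsEndpointApprox.congr`), `δ ↦ δ / s` maps `𝓝[>] 0` into
itself, so its avoidance values tend to `r₁`; approximation independence at `(E, E')` between it
and `(c, d)` gives `r₁ = r₂`.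

Sources: G. F. Lawler, O. Schramm, W. Werner, *On the scaling limit of planar self-avoiding
walk* (2004), §3.4.2 (`(λΩ)_δ = λ·Ω_{δ/λ}`, lattice symmetries of subsequential limits);
V. Beffara, *Is critical 2D percolation universal?* (2008), §2.2. All [folklore].
-/

noncomputable section

open scoped Topology ENNReal NNReal
open Filter Set MeasureTheory
open Literature.Probability.RandomPlanarGeometry Literature.Probability.LatticeModels

namespace Summit.CriticalPhenomena.SAWScalingLimit.Theorems.ConformalAvoidance

/-- The avoidance event of `closure (φ '' S)` pulls back along the push-forward of curve classes
by a homeomorphism `φ` of the plane to the avoidance event of `closure S`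
(`range (φ ∘ γ) = φ '' range γ`, `closure (φ '' S) = φ '' closure S`). [folklore] -/
theorem preimage_curveClassMap_rangeSubset_closure_image (φ : ℂ ≃ₜ ℂ) (S : Set ℂ) :
    (CurveClass.map (φ : C(ℂ, ℂ))) ⁻¹' CurveClass.rangeSubset (closure (φ '' S)) =
      CurveClass.rangeSubset (closure S) := by
  ext c
  rw [mem_preimage, CurveClass.mem_rangeSubset, CurveClass.mem_rangeSubset, CurveClass.range_map,
    ← Homeomorph.image_closure]
  exact image_subset_image_iff φ.injective

/-- **Mesh-by-mesh dilation identity for avoidance probabilities**: the probability that the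
critical SAW of `(sΩ)_δ` from `x` to `y` stays in `closure (s S)` equals the probability that the
critical SAW of `Ω_{δ/s}` from `x` to `y` stays in `closure S` (`(sΩ)_δ = s · Ω_{δ/s}`,
`map_curve_law_dilate`, evaluated on the closed avoidance event). [folklore] -/
theorem avoidance_dilate {s : ℝ} (hs0 : 0 < s) (hs : (s : ℂ) ≠ 0) (Ω S : Set ℂ) (δ : ℝ)
    (x y : Site 2) :
    ((SAW.law ((similarity (s : ℂ) hs 0) '' Ω) δ x y).map (fun γ => γ.curve))
        (CurveClass.rangeSubset (closure ((similarity (s : ℂ) hs 0) '' S))) =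
      ((SAW.law Ω (δ / s) x y).map (fun γ => γ.curve))
        (CurveClass.rangeSubset (closure S)) := by
  rw [← LatticeSimilarityOfLimit.map_curve_law_dilate hs0 hs Ω δ x y,
    Measure.map_apply (measurable_curveClassMap_similarity _ _ _)
      (CurveClass.measurableSet_rangeSubset isClosed_closure),
    preimage_curveClassMap_rangeSubset_closure_image]

/-- **STUB 2c of line `birth` (crux `ConformalAvoidance`, route `SAWTensorRG`): approximation
independence ⇒ dilation invariance of the avoidance limits.** If two endpoint approximations of
the same hull pair always give the same avoidance limit, then for `E = s D`, `E' = s D'`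
(`s > 0`; carriers and marked points transported by `z ↦ s z`), an endpoint approximation
`(a, b)` of `D` with avoidance limit `r₁` and an endpoint approximation `(c, d)` of `E` with
avoidance limit `r₂`, one has `r₁ = r₂`: the transported approximation `δ ↦ (a (δ/s), b (δ/s))`
of `E` has avoidance values `Av(D, D'; a, b)(δ / s) → r₁` by the exact lattice identity
`(sΩ)_δ = s · Ω_{δ/s}` (`avoidance_dilate`), and approximation independence at `(E, E')`
compares it with `(c, d)`. [folklore] -/
theorem stub_dilationInvariantLimits :
    (∀ (D D' : DobrushinDomain) (a b c d : ℝ → Site 2),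
       SAW.IsEndpointApprox D a b → SAW.IsEndpointApprox D c d →
       D'.carrier ⊆ D.carrier → D'.pt 0 = D.pt 0 → D'.pt 1 = D.pt 1 →
       (∃ ε : ℝ, 0 < ε ∧ D'.carrier ∩ Metric.ball (D.pt 0) ε = D.carrier ∩ Metric.ball (D.pt 0) ε ∧
         D'.carrier ∩ Metric.ball (D.pt 1) ε = D.carrier ∩ Metric.ball (D.pt 1) ε) →
       ∀ r₁ r₂ : ENNReal,
         Tendsto (fun δ => ((SAW.law D.carrier δ (a δ) (b δ)).map (fun γ => γ.curve))
             (CurveClass.rangeSubset (closure D'.carrier))) (𝓝[>] 0) (𝓝 r₁) →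
         Tendsto (fun δ => ((SAW.law D.carrier δ (c δ) (d δ)).map (fun γ => γ.curve))
             (CurveClass.rangeSubset (closure D'.carrier))) (𝓝[>] 0) (𝓝 r₂) → r₁ = r₂) →
    ∀ (D D' E E' : DobrushinDomain) (a b c d : ℝ → Site 2) (s : ℝ) (hs : (s : ℂ) ≠ 0),
      0 < s →
      SAW.IsEndpointApprox D a b → SAW.IsEndpointApprox E c d →
      D'.carrier ⊆ D.carrier → D'.pt 0 = D.pt 0 → D'.pt 1 = D.pt 1 →
      (∃ ε : ℝ, 0 < ε ∧ D'.carrier ∩ Metric.ball (D.pt 0) ε = D.carrier ∩ Metric.ball (D.pt 0) ε ∧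
        D'.carrier ∩ Metric.ball (D.pt 1) ε = D.carrier ∩ Metric.ball (D.pt 1) ε) →
      E'.carrier ⊆ E.carrier → E'.pt 0 = E.pt 0 → E'.pt 1 = E.pt 1 →
      (∃ ε : ℝ, 0 < ε ∧ E'.carrier ∩ Metric.ball (E.pt 0) ε = E.carrier ∩ Metric.ball (E.pt 0) ε ∧
        E'.carrier ∩ Metric.ball (E.pt 1) ε = E.carrier ∩ Metric.ball (E.pt 1) ε) →
      E.carrier = (similarity (s : ℂ) hs 0) '' D.carrier →
      E'.carrier = (similarity (s : ℂ) hs 0) '' D'.carrier →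
      E.pt 0 = (similarity (s : ℂ) hs 0) (D.pt 0) → E.pt 1 = (similarity (s : ℂ) hs 0) (D.pt 1) →
      ∀ r₁ r₂ : ENNReal,
        Tendsto (fun δ => ((SAW.law D.carrier δ (a δ) (b δ)).map (fun γ => γ.curve))
            (CurveClass.rangeSubset (closure D'.carrier))) (𝓝[>] 0) (𝓝 r₁) →
        Tendsto (fun δ => ((SAW.law E.carrier δ (c δ) (d δ)).map (fun γ => γ.curve))
            (CurveClass.rangeSubset (closure E'.carrier))) (𝓝[>] 0) (𝓝 r₂) → r₁ = r₂ := by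
  intro hAIL D D' E E' a b c d s hs hs0 hab hcd _ _ _ _ hE'sub hE'0 hE'1 hE'ball hE hE' hE0 hE1
    r₁ r₂ hr₁ hr₂
  -- (i) the transported endpoint approximation `δ ↦ (a (δ/s), b (δ/s))` of `E = s D`
  have happ : SAW.IsEndpointApprox E (fun δ => a (δ / s)) (fun δ => b (δ / s)) :=
    (LatticeSimilarityOfLimit.isEndpointApprox_dilate hs0 hs hab).congr
      (by rw [MarkedDomain.carrier_map, hE]) (by rw [MarkedDomain.pt_map, hE0])
      (by rw [MarkedDomain.pt_map, hE1])
  -- (ii) `δ ↦ δ / s` maps the filter `δ → 0+` into itself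
  have hdiv : Tendsto (fun δ : ℝ => δ / s) (𝓝[>] (0 : ℝ)) (𝓝[>] (0 : ℝ)) := by
    refine tendsto_nhdsWithin_iff.2 ⟨?_, ?_⟩
    · have h : Tendsto (fun δ : ℝ => δ / s) (𝓝 (0 : ℝ)) (𝓝 (0 / s)) := tendsto_id.div_const s
      rw [zero_div] at h
      exact h.mono_left nhdsWithin_le_nhds
    · filter_upwards [self_mem_nhdsWithin] with δ hδ
      exact div_pos hδ hs0
  -- (iii) the avoidance values of the transported approximation are `Av(D, D'; a, b)(δ / s) → r₁`
  have h₁ : Tendsto (fun δ => ((SAW.law E.carrier δ (a (δ / s)) (b (δ / s))).map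
      (fun γ => γ.curve)) (CurveClass.rangeSubset (closure E'.carrier))) (𝓝[>] 0) (𝓝 r₁) := by
    rw [hE, hE']
    exact (hr₁.comp hdiv).congr fun δ =>
      (avoidance_dilate hs0 hs D.carrier D'.carrier δ (a (δ / s)) (b (δ / s))).symm
  -- (iv) approximation independence at `(E, E')`
  exact hAIL E E' _ _ c d happ hcd hE'sub hE'0 hE'1 hE'ball r₁ r₂ h₁ hr₂

end Summit.CriticalPhenomena.SAWScalingLimit.Theorems.ConformalAvoidance

end
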